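import Summits.QuantumAdvantage.QuantumAdvantage.Theses.LinnikCubicClassGroups
import Literature.Computability.Cryptography.CubicClassSamplingSpecs
import Literature.Computability.Cryptography.CubicClassStageParams
import Literature.Computability.Cryptography.ShiftSamplingReadout
import Literature.Computability.Complexity.CodeFPListKit
import Literature.Computability.Complexity.CodeFPStrings
import Literature.Computability.Complexity.CodeFPStringKit
import Literature.Computability.Complexity.CodeFPBudgets
import Literature.Computability.Complexity.E3InstanceMachine

/-!
# Crux `LinnikCubicClassGroups.PureCubicClassGroupFBQP` (stmt-QuantumAdvantage-11544) — ASM programs (Qry)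

Line `arakelov-giant-step-cycle`, stub `stub_classStageAssembly` (S5b-ASM), helper `classStage_qry`: the QUERY
program of the class-group stage — on a well-formed input `w = ⟨x, ⟨⟨f, a, b⟩, ps⟩⟩` it asks the regulator oracle
for advice of precision `k(w) = kOf |w| a b ps`, i.e. it outputs `⟨⟨x, ⟨f, a, b⟩⟩, 1^{k(w)}⟩` — together with the
kit it is built from and which the PRE- and POST-processor files reuse: every parameter function of
`Literature/Computability/Cryptography/CubicClassStageParams.lean` (`Z, e6, LB, LD, KN, sOf, Tp, leOf, kOf, precOf,
capOf, lbOf, lkOf, topOf, hB, K0Of`) is computed on codes in polynomial time (`CodeFP` facts of the tree's typed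
calculus `Complexity/CodeFP*.lean`), the small ones in UNARY (unary sums/products `unAdd`/`CodeFP.unMul`, sizes
of numerals as lengths `length_natE`, the maximum of a list `natMaxList`), `capOf`, `hB`, `K0Of` in binary. The
argument tuple of the kit is `(n, a, b, ps)` coded by `pairE unE (pairE natE (pairE natE (rawE natE)))` (`n` unary,
`a`, `b` binary, `ps` a raw list of binary numerals).

The input is read TYPED: `w` is literally the code `pairE strE (pairE (pairE natE (pairE natE natE)) (listE natE))`
of the tuple `(x, (f, a, b), ps)` (`listE_eq`: `encodingListNatBool.encode = listE natE`), so no decoder is needed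
and the statement `∃ qry ∈ FP, …` is the unpacking of one `CodeFP` fact. Definition-free.
-/

-- the problem namespace repeats the summit name (`QuantumAdvantage.QuantumAdvantage`)
set_option linter.dupNamespace false

namespace Summit.QuantumAdvantage.QuantumAdvantage.Theorems.LinnikCubicClassGroups

open Computability (encodeNat decodeNat encodingNatBool)
open Literature.Computability.Complexity (boolPair boolUnpair CodeFP FP encodingListNatBool length_boolPair)
open Literature.Computability.Complexity.CodeFP
open Literature.Computability.Complexity.MachineA (unSub)
open Literature.Computability.Cryptography (CubicClassTable.WalkFns CubicClassTable.Inst)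
open Literature.Computability.Cryptography.CubicClassSampling (TableArgs tableArgsE instOfArgs PostArgs postArgsE
  postOfArgs)
open Literature.Computability.Cryptography.CubicClassStageParams

/-! ## The parameter functions of `CubicClassStageParams` on codes -/

/-- The size of a unary numeral, in unary (the size of a binary numeral is the length of its code, `length_natE`). -/
theorem classStage_codeFP_sizeUnUn : CodeFP unE unE Nat.size :=
  ((strLength.comp strOfNat).comp natOfUn).congr fun n => length_natE n

/-- `Z n = 2^17 (n+8)^3`, in unary. -/
theorem classStage_codeFP_Z : CodeFP unE unE Z := by
  have h8 : CodeFP unE unE (fun n => n + 8) := (unAdd.comp ((CodeFP.id unE).pair (const unE 8)) :)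
  have h3 : CodeFP unE unE (fun n => (n + 8) * ((n + 8) * (n + 8))) :=
    (unMul.comp (h8.pair (unMul.comp (h8.pair h8))) :)
  exact (((unMulConst (2 ^ 17)).comp h3) :).congr fun n => by simp only [Z]; ring

/-- `e6 n = 2 size(Z n + 4) + 20`, in unary. -/
theorem classStage_codeFP_e6 : CodeFP unE unE e6 := by
  have h1 : CodeFP unE unE (fun n => Nat.size (Z n + 4)) :=
    (classStage_codeFP_sizeUnUn.comp (unAdd.comp (classStage_codeFP_Z.pair (const unE 4))) :)
  exact ((unAdd.comp (((unMulConst 2).comp h1).pair (const unE 20))) :).congr fun _ => rfl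

/-- `LB n = 20 n + 75`, in unary. -/
theorem classStage_codeFP_LB : CodeFP unE unE LB :=
  ((unAdd.comp ((unMulConst 20).pair (const unE 75))) :).congr fun _ => rfl

/-- `LD a b = size (27 a² b²)`, in unary from binary `a`, `b`. -/
theorem classStage_codeFP_LD : CodeFP (pairE natE natE) unE (fun p => LD p.1 p.2) := by
  have hsz : CodeFP natE unE Nat.size := (strLength.comp strOfNat).congr fun n => length_natE n
  have ha := fst natE natE
  have hb := snd natE natE
  have h : CodeFP (pairE natE natE) natE (fun p => 27 * (p.1 * p.1) * (p.2 * p.2)) :=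
    (natMul.comp ((natMul.comp ((const _ 27).pair (natMul.comp (ha.pair ha)))).pair (natMul.comp (hb.pair hb))) :)
  exact ((hsz.comp h) :).congr fun p => by simp only [LD, sq]

/-- `KN a b = 10 size(ab) + 48`, in unary from binary `a`, `b`. -/
theorem classStage_codeFP_KN : CodeFP (pairE natE natE) unE (fun p => KN p.1 p.2) := by
  have hsz : CodeFP natE unE Nat.size := (strLength.comp strOfNat).congr fun n => length_natE n
  exact ((unAdd.comp (((unMulConst 10).comp (hsz.comp natMul)).pair (const _ 48))) :).congr fun _ => rfl

/-- `Tp ps = 3 |ps|`, in unary from the raw list. -/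
theorem classStage_codeFP_Tp : CodeFP (rawE natE) unE Tp :=
  (((unMulConst 3).comp (ulength natE)) :).congr fun _ => rfl

/-- `hB m = (27 m²)^10`, in binary. -/
theorem classStage_codeFP_hB : CodeFP natE natE hB :=
  ((natPow.comp ((natMul.comp ((const _ 27).pair (natMul.comp ((CodeFP.id natE).pair (CodeFP.id natE))))).pair
    (const _ 10))) :).congr fun m => by simp only [hB, sq, id]

/-- `sOf n a b`, in unary, on the argument tuple `(n, a, b, ps)`. -/
theorem classStage_codeFP_sOf :
    CodeFP (pairE unE (pairE natE (pairE natE (rawE natE)))) unE (fun q => sOf q.1 q.2.1 q.2.2.1) := by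
  have hn : CodeFP (pairE unE (pairE natE (pairE natE (rawE natE)))) unE (fun q => q.1) := fst _ _
  have hab : CodeFP (pairE unE (pairE natE (pairE natE (rawE natE)))) (pairE natE natE) (fun q => (q.2.1, q.2.2.1)) :=
    (snd _ _).fst'.pair (snd _ _).snd'.fst'
  exact ((unAdd.comp ((unAdd.comp ((unAdd.comp ((((unMulConst 6).comp (classStage_codeFP_LD.comp hab))).pair
    (classStage_codeFP_LB.comp hn))).pair ((unMulConst 2).comp (classStage_codeFP_e6.comp hn)))).pair
    (const _ 60))) :).congr fun _ => rfl

/-- `leOf n a b ps`, in unary, on the argument tuple. -/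
theorem classStage_codeFP_leOf :
    CodeFP (pairE unE (pairE natE (pairE natE (rawE natE)))) unE (fun q => leOf q.1 q.2.1 q.2.2.1 q.2.2.2) := by
  have hn : CodeFP (pairE unE (pairE natE (pairE natE (rawE natE)))) unE (fun q => q.1) := fst _ _
  have hps : CodeFP (pairE unE (pairE natE (pairE natE (rawE natE)))) (rawE natE) (fun q => q.2.2.2) :=
    (snd _ _).snd'.snd'
  have hT1 : CodeFP (pairE unE (pairE natE (pairE natE (rawE natE)))) unE (fun q => Tp q.2.2.2 + 1) :=
    (unSucc.comp (classStage_codeFP_Tp.comp hps) :)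
  have hE : CodeFP (pairE unE (pairE natE (pairE natE (rawE natE)))) unE (fun q => e6 q.1) :=
    classStage_codeFP_e6.comp hn
  have hL : CodeFP (pairE unE (pairE natE (pairE natE (rawE natE)))) unE (fun q => LB q.1) :=
    classStage_codeFP_LB.comp hn
  have hmid : CodeFP (pairE unE (pairE natE (pairE natE (rawE natE)))) unE
      (fun q => e6 q.1 + 10 + LB q.1 + Nat.size (Tp q.2.2.2 + 1)) :=
    (unAdd.comp ((unAdd.comp ((unAdd.comp (hE.pair (const _ 10))).pair hL)).pair
      (classStage_codeFP_sizeUnUn.comp hT1)) :)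
  exact ((unAdd.comp ((unAdd.comp ((unAdd.comp ((unAdd.comp (((unMulConst 3).comp hL).pair
    (unMul.comp (hT1.pair hmid)))).pair classStage_codeFP_sOf)).pair hE)).pair (const _ 40))) :).congr fun _ => rfl

/-- **`kOf n a b ps` (the advice precision), in unary, on the argument tuple.** -/
theorem classStage_codeFP_kOf :
    CodeFP (pairE unE (pairE natE (pairE natE (rawE natE)))) unE (fun q => kOf q.1 q.2.1 q.2.2.1 q.2.2.2) := by
  have hn : CodeFP (pairE unE (pairE natE (pairE natE (rawE natE)))) unE (fun q => q.1) := fst _ _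
  have hab : CodeFP (pairE unE (pairE natE (pairE natE (rawE natE)))) (pairE natE natE) (fun q => (q.2.1, q.2.2.1)) :=
    (snd _ _).fst'.pair (snd _ _).snd'.fst'
  have hps : CodeFP (pairE unE (pairE natE (pairE natE (rawE natE)))) (rawE natE) (fun q => q.2.2.2) :=
    (snd _ _).snd'.snd'
  exact ((unAdd.comp ((unAdd.comp ((unAdd.comp ((unAdd.comp ((unAdd.comp (classStage_codeFP_leOf.pair
    classStage_codeFP_sOf)).pair (const _ 60))).pair ((unMulConst 6).comp (classStage_codeFP_LD.comp hab)))).pair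
    ((unMulConst 2).comp (classStage_codeFP_e6.comp hn)))).pair
    ((unMulConst 2).comp (classStage_codeFP_sizeUnUn.comp ((ulength natE).comp hps))))) :).congr fun _ => rfl

/-- `precOf n a b ps = kOf + sOf + 64`, in unary, on the argument tuple. -/
theorem classStage_codeFP_precOf :
    CodeFP (pairE unE (pairE natE (pairE natE (rawE natE)))) unE (fun q => precOf q.1 q.2.1 q.2.2.1 q.2.2.2) :=
  ((unAdd.comp ((unAdd.comp (classStage_codeFP_kOf.pair classStage_codeFP_sOf)).pair (const _ 64))) :).congr
    fun _ => rfl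

/-- `capOf a b ps = (243 a² b² (pmax + 1))²`, in binary, on the argument tuple. -/
theorem classStage_codeFP_capOf :
    CodeFP (pairE unE (pairE natE (pairE natE (rawE natE)))) natE (fun q => capOf q.2.1 q.2.2.1 q.2.2.2) := by
  have ha : CodeFP (pairE unE (pairE natE (pairE natE (rawE natE)))) natE (fun q => q.2.1) := (snd _ _).fst'
  have hb : CodeFP (pairE unE (pairE natE (pairE natE (rawE natE)))) natE (fun q => q.2.2.1) := (snd _ _).snd'.fst'
  have hps : CodeFP (pairE unE (pairE natE (pairE natE (rawE natE)))) (rawE natE) (fun q => q.2.2.2) :=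
    (snd _ _).snd'.snd'
  have hmax : CodeFP (pairE unE (pairE natE (pairE natE (rawE natE)))) natE (fun q => q.2.2.2.foldr max 0 + 1) :=
    (natAdd.comp ((natMaxList.comp hps).pair (const _ 1)) :)
  have hbase : CodeFP (pairE unE (pairE natE (pairE natE (rawE natE)))) natE
      (fun q => 243 * (q.2.1 * q.2.1) * (q.2.2.1 * q.2.2.1) * (q.2.2.2.foldr max 0 + 1)) :=
    (natMul.comp ((natMul.comp ((natMul.comp ((const _ 243).pair (natMul.comp (ha.pair ha)))).pair
      (natMul.comp (hb.pair hb)))).pair hmax) :)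
  exact ((natMul.comp (hbase.pair hbase)) :).congr fun q => by simp only [capOf, sq]

/-- `lbOf n a b ps` (coins per prime), in unary, on the argument tuple. -/
theorem classStage_codeFP_lbOf :
    CodeFP (pairE unE (pairE natE (pairE natE (rawE natE)))) unE (fun q => lbOf q.1 q.2.1 q.2.2.1 q.2.2.2) := by
  have hsz : CodeFP natE unE Nat.size := (strLength.comp strOfNat).congr fun n => length_natE n
  have hn : CodeFP (pairE unE (pairE natE (pairE natE (rawE natE)))) unE (fun q => q.1) := fst _ _
  have hps : CodeFP (pairE unE (pairE natE (pairE natE (rawE natE)))) (rawE natE) (fun q => q.2.2.2) :=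
    (snd _ _).snd'.snd'
  have h1 : CodeFP (pairE unE (pairE natE (pairE natE (rawE natE)))) unE
      (fun q => Nat.size (capOf q.2.1 q.2.2.1 q.2.2.2) + 2) :=
    (unAdd.comp ((hsz.comp classStage_codeFP_capOf).pair (const _ 2)) :)
  have h2 : CodeFP (pairE unE (pairE natE (pairE natE (rawE natE)))) unE
      (fun q => 50 + 2 * e6 q.1 + Nat.size q.2.2.2.length) :=
    (unAdd.comp ((unAdd.comp ((const _ 50).pair ((unMulConst 2).comp (classStage_codeFP_e6.comp hn)))).pair
      (classStage_codeFP_sizeUnUn.comp ((ulength natE).comp hps))) :)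
  exact ((unMul.comp (((unMulConst 24).comp h1).pair h2)) :).congr fun _ => rfl

/-- `lkOf n a b ps = |ps| · lbOf`, in unary, on the argument tuple. -/
theorem classStage_codeFP_lkOf :
    CodeFP (pairE unE (pairE natE (pairE natE (rawE natE)))) unE (fun q => lkOf q.1 q.2.1 q.2.2.1 q.2.2.2) := by
  have hps : CodeFP (pairE unE (pairE natE (pairE natE (rawE natE)))) (rawE natE) (fun q => q.2.2.2) :=
    (snd _ _).snd'.snd'
  exact ((unMul.comp (((ulength natE).comp hps).pair classStage_codeFP_lbOf)) :).congr fun _ => rfl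

/-- `topOf n a b ps = (Z+1)² − s − ℓe·T`, in unary, on the argument tuple. -/
theorem classStage_codeFP_topOf :
    CodeFP (pairE unE (pairE natE (pairE natE (rawE natE)))) unE (fun q => topOf q.1 q.2.1 q.2.2.1 q.2.2.2) := by
  have hn : CodeFP (pairE unE (pairE natE (pairE natE (rawE natE)))) unE (fun q => q.1) := fst _ _
  have hps : CodeFP (pairE unE (pairE natE (pairE natE (rawE natE)))) (rawE natE) (fun q => q.2.2.2) :=
    (snd _ _).snd'.snd'
  have hZ1 : CodeFP (pairE unE (pairE natE (pairE natE (rawE natE)))) unE (fun q => Z q.1 + 1) :=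
    (unSucc.comp (classStage_codeFP_Z.comp hn) :)
  have hsq : CodeFP (pairE unE (pairE natE (pairE natE (rawE natE)))) unE (fun q => (Z q.1 + 1) * (Z q.1 + 1)) :=
    (unMul.comp (hZ1.pair hZ1) :)
  exact ((unSub.comp ((unSub.comp (hsq.pair classStage_codeFP_sOf)).pair
    (unMul.comp (classStage_codeFP_leOf.pair (classStage_codeFP_Tp.comp hps))))) :).congr fun q => by
      simp only [topOf, sq]

/-- `K0Of n a b mx = ⌊2^s / (2^(e₆+8) hB mx)⌋`, in binary, on the argument tuple and `mx`. -/
theorem classStage_codeFP_K0Of : CodeFP (pairE (pairE unE (pairE natE (pairE natE (rawE natE)))) natE) natE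
    (fun p => K0Of p.1.1 p.1.2.1 p.1.2.2.1 p.2) := by
  have h2s : CodeFP (pairE (pairE unE (pairE natE (pairE natE (rawE natE)))) natE) natE
      (fun p => 2 ^ sOf p.1.1 p.1.2.1 p.1.2.2.1) :=
    (natPow.comp ((const _ 2).pair (classStage_codeFP_sOf.comp (fst _ _))) :)
  have hden : CodeFP (pairE (pairE unE (pairE natE (pairE natE (rawE natE)))) natE) natE
      (fun p => 2 ^ (e6 p.1.1 + 8) * hB p.2) :=
    (natMul.comp ((natPow.comp ((const _ 2).pair (unAdd.comp ((classStage_codeFP_e6.comp (fst _ _).fst').pair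
      (const _ 8))))).pair (classStage_codeFP_hB.comp (snd _ _))) :)
  exact ((natDiv.comp (h2s.pair hden)) :).congr fun _ => rfl

/-! ## The query program

The typed input `t = (x, (f, a, b), ps)` is coded by `pairE strE (pairE (pairE natE (pairE natE natE)) (listE natE))`,
literally the stage's input format. -/

/-- **The kit's argument tuple `(|w|, a, b, ps)` is read off the typed input in polynomial time.** -/
theorem classStage_codeFP_args : CodeFP (pairE strE (pairE (pairE natE (pairE natE natE)) (listE natE)))
    (pairE unE (pairE natE (pairE natE (rawE natE))))
    (fun t => ((pairE strE (pairE (pairE natE (pairE natE natE)) (listE natE)) t).length,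
      t.2.1.2.1, t.2.1.2.2, t.2.2)) := by
  have hE : CodeFP (pairE strE (pairE (pairE natE (pairE natE natE)) (listE natE))) strE
      (fun t => (pairE strE (pairE (pairE natE (pairE natE natE)) (listE natE)) t)) :=
    ⟨id, Literature.Computability.Complexity.PolyTimeComputable.id _, fun _ => rfl⟩
  exact ((strLength.comp hE).pair ((snd _ _).fst'.snd'.fst'.pair ((snd _ _).fst'.snd'.snd'.pair
    ((rawOfList natE).comp (snd _ _).snd'))) :)

/-- **ASM helper `classStage_qry`** (registered): the query program of the class-group stage is in `FP` — on a
well-formed input `w = ⟨x, ⟨⟨f, a, b⟩, ps⟩⟩` it outputs the regulator query `⟨⟨x, ⟨f, a, b⟩⟩, 1^{kOf |w| a b ps}⟩`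
(string projections, the kit's `kOf` in unary, re-pairing; nothing is claimed off well-formed inputs). -/
theorem classStage_qry :
    ∃ qry : List Bool → List Bool, qry ∈ FP ∧
      ∀ (x : List Bool) (f a b : ℕ) (ps : List ℕ) (w : List Bool),
        w = boolPair x (boolPair (boolPair (encodeNat f) (boolPair (encodeNat a) (encodeNat b))) (encodingListNatBool.encode ps)) →
        qry w = boolPair (boolPair x (boolPair (encodeNat f) (boolPair (encodeNat a) (encodeNat b))))
          (List.replicate (kOf w.length a b ps) true) := by
  have hk : CodeFP (pairE strE (pairE (pairE natE (pairE natE natE)) (listE natE))) unE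
      (fun t => kOf (pairE strE (pairE (pairE natE (pairE natE natE)) (listE natE)) t).length
        t.2.1.2.1 t.2.1.2.2 t.2.2) := (classStage_codeFP_kOf.comp classStage_codeFP_args :)
  have hG : CodeFP (pairE strE (pairE (pairE natE (pairE natE natE)) (listE natE)))
      (pairE (pairE strE (pairE natE (pairE natE natE))) unE)
      (fun t => ((t.1, t.2.1), kOf (pairE strE (pairE (pairE natE (pairE natE natE)) (listE natE)) t).length
        t.2.1.2.1 t.2.1.2.2 t.2.2)) := (((fst _ _).pair (snd _ _).fst').pair hk :)
  obtain ⟨F, hF, hFe⟩ := hG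
  refine ⟨F, hF, fun x f a b ps w hw => ?_⟩
  have e := hFe (x, (f, a, b), ps)
  simp only [pairE_apply, strE, id] at e
  rw [show encodingListNatBool.encode ps = listE natE ps from congrFun (listE_eq encodingNatBool) ps] at hw
  subst hw
  rw [e, unE_eq_ones]

end Summit.QuantumAdvantage.QuantumAdvantage.Theorems.LinnikCubicClassGroups
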